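import Summits.CriticalPhenomena.PercolationContinuityZ3.Theorems.PercNearOneGluingNoHeavyLowerTailSahiCTCC2LevelTwoVertex
import Summits.CriticalPhenomena.PercolationContinuityZ3.Theorems.PercNearOneGluingNoHeavyLowerTailSahiCTCCoLevelTwoSplit
import Summits.CriticalPhenomena.PercolationContinuityZ3.Theorems.PercNearOneGluingNoHeavyLowerTailSahiCTCLadderTwo
import HarnessLib

/-!
# `NoHeavyLowerTail` (crux stmt-CriticalPhenomena-4575), P3 lane: the CROSSED form `V_τ` of an all-live pair IS the ladder form plus a Kleitman term —
# `V_τ = Θ_τ·(2H − Θ_τ·Y_{=τ}) + L_τ` for `τ`-live pairs, hence `V_τ ∈ ℕ[s]` whenever `L_τ ∈ ℕ[s]`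

Support file (seat `prim-l12-p3`, gen 42; `--supports stmt-CriticalPhenomena-4575`).  Memo
`run/shared/lean/prim/prim-l12/FROM-prim-l12-p3-g42-C2-LEVEL-TWO.md` §6.  g41's crossed form (memo g41 §4.5b; = the C2/C1 slice of an idle coordinate, memo g42 §1.2)
    `V_τ = Θ_{τ+1}·(Π·Y_{≥τ} − X·Z) + Θ_τ·(Π·Y_{≥τ+1} − X·Z) + Π·(X_{<τ}·Z_{≤τ} + X_{≤τ}·Z_{<τ})`     (`Θ_τ = GF({#S < τ})`)
for a pair of `τ`-LIVE up-sets (all members of size `≥ τ`) satisfies the polynomial identity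
    **`V_τ = Θ_τ·(2·H − Θ_τ·Y_{=τ}) + L_τ`**,   `H = Π·Y − X·Z`,  `L_τ = ladderT τ` = `e_τ·H − Θ_τ·e_{≥τ}·Y_{=τ}` (the ladder form of `…SahiCTCRtForm`)
(`crossedLive_eq_ladder_add`; cf. `M_t = Π·L_t + e_t·R_t` there), and `H − Θ_τ·Y_{=τ} ∈ ℕ[s]` for `τ`-live pairs (`coeff_bySize_mul_exact_le_harris`: at a profile
carrying `Θ_τ·Y_{=τ}` the two traces have total size `< 2τ`, so the product `X·Z` has no term there and `U ↦ s∖U` injects into the common trace).  Hence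
**`coeff_crossedLive_nonneg_of_ladder`**: `V_τ ∈ ℕ[s]` for every `τ`-live pair with `L_τ ∈ ℕ[s]` — with `…SahiCTCLadderTwo.coeff_ladder_two_nonneg` (gen 25, landed
gen 42) this is UNCONDITIONAL at `τ = 2`: `coeff_crossedLive_two_nonneg` (g41 §7 item 3, 'crossed TP for τ ≥ 2', in the all-live regime = the idle slice of C2
at `t = 3` for 2-live pairs), and with `…SahiCTCLadderSqfreeT.coeff_ladder_sqfree_nonneg` it holds at every squarefree profile for every `τ ≥ 1`
(`coeff_crossedLive_sqfree_nonneg`).  Nothing is asserted about the crux.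
-/

noncomputable section

open scoped Classical

namespace Summit.CriticalPhenomena.PercolationContinuityZ3.Theorems.SahiCTCForms

open Finset MvPolynomial SahiCTCGenFun

variable {α : Type*} [DecidableEq α] [Fintype α]

section Live
variable {F G : Finset (Finset α)} {t : ℕ}

omit [DecidableEq α] [Fintype α] in
/-- A `t`-live family has no member of size `< t`. [this work] -/
theorem below_eq_empty_of_live (hF : ∀ S ∈ F, t ≤ #S) : below t F = ∅ :=
  filter_eq_empty_iff.2 fun S hS h => absurd (hF S hS) (by omega)

omit [DecidableEq α] [Fintype α] in
/-- A `t`-live family is its own `atLeast t` part. [this work] -/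
theorem atLeast_eq_self_of_live (hF : ∀ S ∈ F, t ≤ #S) : atLeast t F = F := filter_true_of_mem hF

omit [Fintype α] in
/-- For a `t`-live family: `GF(members of size ≥ t+1) = GF(F) − GF(members of size = t)`. [this work] -/
theorem gf_atLeast_succ_of_live (hF : ∀ S ∈ F, t ≤ #S) : gf (atLeast (t + 1) F) = gf F - gf (exact t F) := by
  rw [eq_sub_iff_add_eq, ← gf_union]
  · congr 1; ext S
    simp only [atLeast, exact, mem_union, mem_filter]
    constructor
    · rintro (⟨h, _⟩ | ⟨h, _⟩) <;> exact h
    · intro h; have := hF S h; by_cases he : #S = t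
      · exact Or.inr ⟨h, he⟩
      · exact Or.inl ⟨h, by omega⟩
  · exact disjoint_left.2 fun S h1 h2 => by
      have a := (mem_filter.1 h1).2; have b := (mem_filter.1 h2).2; omega

/-- `Θ_{t+1} = Θ_t + e_t`. [this work] -/
theorem gf_bySize_lt_succ (t : ℕ) : gf (bySize (· < t + 1) : Finset (Finset α)) = gf (bySize (· < t)) + ee t := by
  unfold ee bySize
  rw [← gf_union]
  · congr 1; ext S; simp only [mem_union, mem_filter, mem_powerset, subset_univ, true_and]; omega
  · exact disjoint_left.2 fun S h1 h2 => by
      have a := (mem_filter.1 h1).2; have b := (mem_filter.1 h2).2; omega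

/-- **`V_τ = Θ_τ·(2H − Θ_τ·Y_{=τ}) + L_τ` for `τ`-live pairs** (polynomial identity). [this work] -/
theorem crossedLive_eq_ladder_add (hF : ∀ S ∈ F, t ≤ #S) (hG : ∀ S ∈ G, t ≤ #S) (hFG : ∀ S ∈ F ∩ G, t ≤ #S) :
    gf (bySize (· < t + 1)) * (PiP * gf (atLeast t (F ∩ G)) - gf F * gf G)
      + gf (bySize (· < t)) * (PiP * gf (atLeast (t + 1) (F ∩ G)) - gf F * gf G)
      + PiP * (gf (below t F) * gf (below (t + 1) G) + gf (below (t + 1) F) * gf (below t G))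
    = gf (bySize (· < t)) * (2 * (PiP * gf (F ∩ G) - gf F * gf G) - gf (bySize (· < t)) * gf (exact t (F ∩ G)))
      + ladderT t F G := by
  unfold ladderT
  rw [below_eq_empty_of_live hF, below_eq_empty_of_live hG, gf_empty, atLeast_eq_self_of_live hFG, atLeast_eq_self_of_live hF,
    atLeast_eq_self_of_live hG, gf_atLeast_succ_of_live hFG, gf_bySize_lt_succ, PiP_eq_bySize_lt_add_ge t]
  ring

/-- **`Θ_τ·Y_{=τ} ≤ H` coefficientwise for `τ`-live pairs.**  At a profile `n ≤ 2` with doubled set `D` and single set `s` that carries a term of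
`Θ_τ·Y_{=τ}` one has `2#D + #s < 2τ`, so no term of `X·Z` lives there (both traces would need size `≥ τ`), while `U ↦ s∖U` injects the terms of `Θ_τ·Y_{=τ}`
into the common trace counted by `Π·Y`. [this work] -/
theorem coeff_bySize_mul_exact_le_harris (hFu : IsUpperSet (F : Set (Finset α))) (hGu : IsUpperSet (G : Set (Finset α)))
    (hF : ∀ S ∈ F, t ≤ #S) (hG : ∀ S ∈ G, t ≤ #S) (n : α →₀ ℕ) :
    (gf (bySize (· < t) : Finset (Finset α)) * gf (exact t (F ∩ G))).coeff n ≤ (PiP * gf (F ∩ G) - gf F * gf G).coeff n := by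
  by_cases hn : ∀ i, n i ≤ 2
  swap
  · rw [coeff_gf_mul_gf_eq_zero _ _ hn, coeff_harrisForm_eq_zero _ _ hn]
  obtain ⟨D, hD⟩ : ∃ D : Finset α, D = dbl n := ⟨_, rfl⟩
  obtain ⟨s, hs⟩ : ∃ s : Finset α, s = sgl n := ⟨_, rfl⟩
  have hDs : Disjoint D s := by rw [hD, hs]; exact disjoint_dbl_sgl n
  obtain ⟨LH, hLH⟩ : ∃ LH : Finset (Finset α),
      LH = (tr (bySize (· < t) : Finset (Finset α)) D s).filter fun U => s \ U ∈ tr (exact t (F ∩ G)) D s := ⟨_, rfl⟩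
  have hcardU : ∀ U, U ⊆ s → #(D ∪ U) = #D + #U := fun U hU => card_union_of_disjoint (hDs.mono_right hU)
  have hmemLH : ∀ U, U ∈ LH → U ⊆ s ∧ #D + #U < t ∧ D ∪ (s \ U) ∈ F ∩ G ∧ #D + #(s \ U) = t := by
    intro U hU
    rw [hLH, mem_filter, mem_tr, mem_tr, mem_bySize_iff] at hU
    obtain ⟨⟨hUs, hlt⟩, _, hex⟩ := hU
    unfold exact at hex
    rw [mem_filter] at hex
    refine ⟨hUs, by rw [← hcardU U hUs]; exact hlt, hex.1, by rw [← hcardU _ sdiff_subset]; exact hex.2⟩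
  by_cases hemp : LH = ∅
  · have h0 : (gf (bySize (· < t) : Finset (Finset α)) * gf (exact t (F ∩ G))).coeff n = 0 := by
      rw [coeff_gf_mul_gf_eq_card_tr _ _ hn, ← hD, ← hs, ← hLH, hemp, card_empty, Nat.cast_zero]
    rw [h0]; exact coeff_harrisForm_nonneg_kap hFu hGu n
  obtain ⟨U₀, hU₀⟩ := nonempty_iff_ne_empty.2 hemp
  obtain ⟨hU₀s, hlt₀, -, heq₀⟩ := hmemLH U₀ hU₀
  have hsd₀ : #(s \ U₀) = #s - #U₀ := card_sdiff_of_subset hU₀s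
  have hle₀ : #U₀ ≤ #s := card_le_card hU₀s
  have hsmall : 2 * #D + #s < 2 * t := by omega
  -- the product `X·Z` has no term at `n`
  have hXZ : ((tr F D s).filter fun U => s \ U ∈ tr G D s) = ∅ := by
    refine filter_eq_empty_iff.2 fun U hU hU' => ?_
    rw [mem_tr] at hU hU'
    have h1 := hF _ hU.2; have h2 := hG _ hU'.2
    rw [hcardU U hU.1] at h1; rw [hcardU _ sdiff_subset, card_sdiff_of_subset hU.1] at h2
    have := card_le_card hU.1; omega
  -- the injection `U ↦ s \\ U` into the common trace
  have hinj : #LH ≤ #(tr (F ∩ G) D s) := by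
    refine card_le_card_of_injOn (fun U => s \ U) (fun U hU => ?_) (fun U hU U' hU' h => ?_)
    · obtain ⟨_, _, hmem, _⟩ := hmemLH U (Finset.mem_coe.1 hU)
      exact Finset.mem_coe.2 (mem_tr.2 ⟨sdiff_subset, hmem⟩)
    · have h1 := (hmemLH U (Finset.mem_coe.1 hU)).1; have h2 := (hmemLH U' (Finset.mem_coe.1 hU')).1
      have h' : s \ (s \ U) = s \ (s \ U') := by simp only at h; rw [h]
      rwa [Finset.sdiff_sdiff_eq_self h1, Finset.sdiff_sdiff_eq_self h2] at h'
  rw [coeff_gf_mul_gf_eq_card_tr _ _ hn, coeff_sub, coeff_PiP_mul_gf_eq_card_tr _ hn, coeff_gf_mul_gf_eq_card_tr _ _ hn, ← hD, ← hs, ← hLH, hXZ,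
    card_empty, Nat.cast_zero, sub_zero]
  exact_mod_cast hinj

/-- **`V_τ ∈ ℕ[s]` at every profile where `L_τ` is, for `τ`-live pairs.** [this work] -/
theorem coeff_crossedLive_nonneg_of_ladder (hFu : IsUpperSet (F : Set (Finset α))) (hGu : IsUpperSet (G : Set (Finset α)))
    (hF : ∀ S ∈ F, t ≤ #S) (hG : ∀ S ∈ G, t ≤ #S) {m : α →₀ ℕ} (hL : 0 ≤ (ladderT t F G).coeff m) :
    0 ≤ (gf (bySize (· < t + 1)) * (PiP * gf (atLeast t (F ∩ G)) - gf F * gf G)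
      + gf (bySize (· < t)) * (PiP * gf (atLeast (t + 1) (F ∩ G)) - gf F * gf G)
      + PiP * (gf (below t F) * gf (below (t + 1) G) + gf (below (t + 1) F) * gf (below t G))).coeff m := by
  have hFG : ∀ S ∈ F ∩ G, t ≤ #S := fun S hS => hF S (mem_inter.1 hS).1
  rw [crossedLive_eq_ladder_add hF hG hFG, coeff_add]
  refine add_nonneg (coeff_mul_nonneg (coeff_gf_nonneg _) (fun n => ?_) m) hL
  rw [coeff_sub, two_mul, coeff_add]
  have h1 := coeff_bySize_mul_exact_le_harris hFu hGu hF hG n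
  have h2 := coeff_harrisForm_nonneg_kap hFu hGu n
  linarith

omit [DecidableEq α] in
/-- For `t ≥ 1`: `bySize (· ≤ t − 1) = bySize (· < t)`. [this work] -/
theorem bySize_le_pred_eq {t : ℕ} (ht : 1 ≤ t) : (bySize (· ≤ t - 1) : Finset (Finset α)) = bySize (· < t) := by
  unfold bySize; ext S; simp only [mem_filter, mem_powerset, subset_univ, true_and]; omega

/-- **`V_τ ∈ ℕ[s]` at every SQUAREFREE profile, for every `τ ≥ 1` and every `τ`-live pair** (from `…SahiCTCLadderSqfreeT.coeff_ladder_sqfree_nonneg`). [this work] -/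
theorem coeff_crossedLive_sqfree_nonneg (hFu : IsUpperSet (F : Set (Finset α))) (hGu : IsUpperSet (G : Set (Finset α)))
    (ht : 1 ≤ t) (hF : ∀ S ∈ F, t ≤ #S) (hG : ∀ S ∈ G, t ≤ #S) (T : Finset α) :
    0 ≤ (gf (bySize (· < t + 1)) * (PiP * gf (atLeast t (F ∩ G)) - gf F * gf G)
      + gf (bySize (· < t)) * (PiP * gf (atLeast (t + 1) (F ∩ G)) - gf F * gf G)
      + PiP * (gf (below t F) * gf (below (t + 1) G) + gf (below (t + 1) F) * gf (below t G))).coeff (ind T) := by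
  have hFG : ∀ S ∈ F ∩ G, t ≤ #S := fun S hS => hF S (mem_inter.1 hS).1
  refine coeff_crossedLive_nonneg_of_ladder hFu hGu hF hG ?_
  have h := coeff_ladder_sqfree_nonneg hFu hGu ht hF hG T
  have e : ladderT t F G = ee t * (PiP * gf (F ∩ G) - gf F * gf G) -
      gf (bySize (· ≤ t - 1) : Finset (Finset α)) * gf (bySize (t ≤ ·) : Finset (Finset α)) * gf ((F ∩ G).filter fun S => #S = t) := by
    unfold ladderT exact
    rw [atLeast_eq_self_of_live hFG, atLeast_eq_self_of_live hF, atLeast_eq_self_of_live hG, bySize_le_pred_eq ht]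
  rw [e]; exact h

/-- ★ **`V_2 ∈ ℕ[s]` for EVERY pair of 2-live up-sets** — g41's crossed form at `τ = 2` in the all-live regime (= the idle slice of C2 at `t = 3` for
2-live pairs), UNCONDITIONALLY, from the ladder theorem `…SahiCTCLadderTwo.coeff_ladder_two_nonneg` (gen 25, landed gen 42). [this work] -/
theorem coeff_crossedLive_two_nonneg (hFu : IsUpperSet (F : Set (Finset α))) (hGu : IsUpperSet (G : Set (Finset α)))
    (hF : ∀ S ∈ F, 2 ≤ #S) (hG : ∀ S ∈ G, 2 ≤ #S) (m : α →₀ ℕ) :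
    0 ≤ (gf (bySize (· < 2 + 1)) * (PiP * gf (atLeast 2 (F ∩ G)) - gf F * gf G)
      + gf (bySize (· < 2)) * (PiP * gf (atLeast (2 + 1) (F ∩ G)) - gf F * gf G)
      + PiP * (gf (below 2 F) * gf (below (2 + 1) G) + gf (below (2 + 1) F) * gf (below 2 G))).coeff m := by
  have hFG : ∀ S ∈ F ∩ G, 2 ≤ #S := fun S hS => hF S (mem_inter.1 hS).1
  refine coeff_crossedLive_nonneg_of_ladder hFu hGu hF hG ?_
  have h := coeff_ladder_two_nonneg hFu hGu hF hG m
  have e : ladderT 2 F G = ee 2 * (PiP * gf (F ∩ G) - gf F * gf G) -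
      Th1 * gf (bySize (2 ≤ ·) : Finset (Finset α)) * gf ((F ∩ G).filter fun S => #S = 2) := by
    unfold ladderT exact Th1
    rw [atLeast_eq_self_of_live hFG, atLeast_eq_self_of_live hF, atLeast_eq_self_of_live hG, bySize_lt_two_eq]
  rw [e]; exact h

end Live

end Summit.CriticalPhenomena.PercolationContinuityZ3.Theorems.SahiCTCForms
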